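import Summits.BirchSwinnertonDyer.BirchSwinnertonDyer.Theorems.EisensteinPrimesX2OrbitSupNorm
import Summits.BirchSwinnertonDyer.BirchSwinnertonDyer.Theorems.EisensteinPrimesMazurMCOnCellBMuPartTight
import Literature.NumberTheory.EllipticCurves.PAdicBSDGreenbergStevensProofs
import Literature.NumberTheory.EllipticCurves.PAdicBSDSplitMultiplicativeProofs
import Literature.NumberTheory.EllipticCurves.PAdicLFunctionIntegralityAtTwoNonsplitMultProofs
import Literature.NumberTheory.EllipticCurves.PAdicLFunctionNonsplitMultiplicativeExistenceProofs
import Literature.Barriers.BirchSwinnertonDyer.EisensteinMuConjecture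
import HarnessLib

/-!
# Crux `MazurMCOnCellB` (stmt-BirchSwinnertonDyer-19033), line `mudescent` v4, stub 3′ `stub_muPart_offLocus`
# (μ-lineage): the typed analytic `μ` at `p ‖ N` READ EXACTLY in Teichmüller-orbit-sum currency —
# `X2.AnalyticMuLE W p m ⟺` «some Néron-normalised orbit sum `ϖ·∑_η [ηu/pⁿ]⁺_f`, `n ≥ 1`, has norm
# `> p^{-(m+1)}`» — and the stub-3′ doors it opens (helper; theorems only, no definition, no named fact)

Cell `bsd-eis`, D-0154 width seat `bsd-line-x2-p1-w2` (gen 3) on crux 3 (row A10, X2b), skeleton of record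
`Cruxes/MazurMCOnCellB/Lines/mudescent.lean` v4 (`460ece00…`; stub 3′ open class-wide; per pair ⟸
`X2.AnalyticMuLE W₀ p 0`, `…MuPartTight.muPart_of_analyticMuLE_zero`, p611858).

THE POINT. Every `μ`-certificate door in the tree (`PAdicLFunctionMuInvariantCertificateProofs` §1,
`PAdicLFunctionRiemannSumCongruenceCertificateProofs`, `X11a.MuCoset.muAnZeroAt_of_cosetTable`) needs a bound
`C ≤ 1` on the CELLS of the measure, i.e. `p`-integral Néron-normalised plus symbols `ϖ·[a/p^m]⁺_f` — obtained
there from `‖ϖ‖_p ≤ 1` (irreducible `E[p]`) and `‖L(E,1)/Ω_E‖_p ≤ 1`. At an X2b étale end NEITHER is available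
(`E[p] ⊃ ℤ/p` up to isogeny; a rational `p`-torsion point puts `p` in the denominator of `L(E,1)/Ω_E`,
`11a3 @ 5`-shape); Wuthrich's `G ∈ Λ` (stub 1) controls the ORBIT sums, not the cells. The companion
`Theorems/EisensteinPrimesX2OrbitSupNorm` (this seat, p614896) proves the isometry `sup_k ‖c_k‖ = sup_{n,s} ‖ν_n(s)‖`
for the `ω⁰`-transform of any bounded distribution with NO cell bound; this file applies it to THE
Mazur–Tate–Teitelbaum function at an odd multiplicative prime, both signs (the transform of `a ↦ a_p^{-n}[a/pⁿ]⁺_f`;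
tree `….tendsto_riemannSum_coeff[_of_nonsplit]`, `exists_isSplitMultPAdicLFunctionOf`,
`exists_isMultPAdicLFunctionOf_neg_one_of_nonsplit`):

* §1 `exists_lt_norm_coeff_iff_exists_lt_norm_orbitSum` (ONE datum `(f, ϖ, ε = a_p, L)`: «some
  `‖[T^k](ϖ·L)‖ > B`» ⟺ «some `‖ϖ‖·‖∑_η [η̄γˢ/p^{n+1}]⁺_f‖ > B`»), `teichOrbitSum_toZModPow_mul`, unit-coset form.
* §2 `analyticMuLE_iff_forall_exists_teichOrbitSum`: **`X2.AnalyticMuLE W p m ⟺ ∀ newform f, ∀ ϖ, ∃ n ≥ 1,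
  ∃ unit u mod pⁿ, p^{-(m+1)} < ‖ϖ · teichOrbitSum f p n u‖_p`** (`p` odd multiplicative; NO integrality /
  special-value / irreducibility hypothesis); `m = 0`: `analyticMuLE_zero_iff_forall_exists_teichOrbitSum_unit`.
* §3 DOORS for stub 3′: `muPart_of_forall_exists_teichOrbitSum_unit` (at a pair, ∘ p611858);
  `forall_offLocus_analyticMuLE_zero_iff_forall_offLocus_teichOrbitSum_unit` (v3 stub ≡ «a unit orbit sum at
  every X2b étale end»: the line's analytic μ-question as a finite plus-symbol statement at `p`-power cusps);
  `stub_muPart_offLocus_of_forall_offLocus_teichOrbitSum_unit` (the REGISTERED v4 signature from that hypothesis).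

HONEST FRAMING: per pair = instrumentation (`p − 1` exact plus symbols at ONE level decide stub 3′ at the pair in
the kernel); class-wide the orbit hypothesis is OPEN exactly as the stub is (Stevens 1989 Conj. IV / Cor. 4.13,
Greenberg–Vatsal 2000 §1 p. 15; no print on type A). Theorems only; no definition, no named fact, no `sorry`;
nothing about any curve asserted; closes no stub; beyond-print theorem: no (MTT §I.10–I.13 folklore made kernel).

References: [MazurTateTeitelbaum1986Invent] §I.10 (ε(p) = 0, α = a_p), §I.11–I.13; [GreenbergVatsal2000] (2)–(3);
[Stevens1989] Conj. IV, Cor. 4.13; [Wuthrich2014] Thm. 16; [Washington1997] §7.1, §12.2.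
-/

set_option autoImplicit false
noncomputable section
open Filter Topology
open scoped Classical MatrixGroups ModularForm
open CongruenceSubgroup WeierstrassCurve Literature.NumberTheory.EllipticCurves
  Literature.NumberTheory.EllipticCurves.ModularForms
  Literature.NumberTheory.EllipticCurves.Rank1Residual
  Summit.BirchSwinnertonDyer.Rank1Residual
  Summit.BirchSwinnertonDyer.BirchSwinnertonDyer.Theorems.EisensteinPrimesX2OrbitSupNorm
open Literature.Barriers.BirchSwinnertonDyer (HasRamifiedOddLineAt)
open Summit.BirchSwinnertonDyer.Rank1Residual.X1.MuLambda (mu)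

set_option linter.dupNamespace false -- summit and sub-problem share a name (D-0017 layout)
namespace Summit.BirchSwinnertonDyer.BirchSwinnertonDyer.Theorems.EisensteinPrimesX2AnalyticMuOrbitSum
variable {p : ℕ} [Fact p.Prime]

/-! ## §1. One datum: coefficients of `ϖ·L` versus Néron-normalised orbit sums -/

section Datum

variable {N : ℕ} (f : CuspForm (Gamma0 N) 2)

/-- **The orbit sum only depends on the Teichmüller coset**: `T_m(ξ̄₀·a) = T_m(a)` for `ξ₀ ∈ μ_{p−1}(ℤ_p)`
(`p` odd, `m ≥ 1`; reindex `η ↦ η ξ₀`). [cite: MazurTateTeitelbaum1986Invent, §I.10 (10.1)] -/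
theorem teichOrbitSum_toZModPow_mul (hp2 : p ≠ 2) {m : ℕ} (hm : 1 ≤ m)
    (ξ₀ : rootsOfUnity (torsionOrder p) ℤ_[p]) (a : ZMod (p ^ m)) :
    teichOrbitSum f p m (PadicInt.toZModPow m ((ξ₀ : ℤ_[p]ˣ) : ℤ_[p]) * a) = teichOrbitSum f p m a := by
  classical
  haveI := neZero_torsionOrder p
  haveI := Fintype.ofFinite (rootsOfUnity (torsionOrder p) ℤ_[p])
  rw [teichOrbitSum_eq_finsum f hp2 hm, teichOrbitSum_eq_finsum f hp2 hm, finsum_eq_sum_of_fintype,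
    finsum_eq_sum_of_fintype]
  refine Fintype.sum_equiv (Equiv.mulRight ξ₀) _ _ fun ξ ↦ ?_
  simp only [Equiv.coe_mulRight, Subgroup.coe_mul, Units.val_mul, map_mul, mul_assoc]

/-- Casting the orbit sum to `ℚ_p`: `((ϖ·T_{n+1}(γˢ) : ℚ) : ℚ_p) = ϖ · ∑_η ([η̄γˢ/p^{n+1}]⁺_f : ℚ_p)` (`p` odd).
[cite: MazurTateTeitelbaum1986Invent, §I.10 (10.1)] -/
theorem ratCast_mul_teichOrbitSum_eq (hp2 : p ≠ 2) (ϖ : ℚ) (n : ℕ) (s : ZMod (p ^ n)) :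
    ((ϖ * teichOrbitSum f p (n + 1) ((cyclotomicGenerator p : ZMod (p ^ (n + 1))) ^ s.val) : ℚ) : ℚ_[p]) =
      ((ϖ : ℚ) : ℚ_[p]) * ∑ᶠ ξ : rootsOfUnity (torsionOrder p) ℤ_[p],
        (ratPlusSymbol f ((((PadicInt.toZModPow (n + 1) ((ξ : ℤ_[p]ˣ) : ℤ_[p])) *
          (cyclotomicGenerator p : ZMod (p ^ (n + 1))) ^ s.val).val : ℚ) / (p : ℚ) ^ (n + 1)) : ℚ_[p]) := by
  classical
  haveI := neZero_torsionOrder p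
  haveI := Fintype.ofFinite (rootsOfUnity (torsionOrder p) ℤ_[p])
  rw [Rat.cast_mul, teichOrbitSum_eq_finsum f hp2 (Nat.succ_le_succ (Nat.zero_le n)),
    finsum_eq_sum_of_fintype, finsum_eq_sum_of_fintype, Rat.cast_sum]

variable {f} {W : WeierstrassCurve ℚ}

/-- **ONE DATUM: large coefficients ⟺ large orbit sums, any threshold.** For a rational newform `f`, `‖ε‖ = 1`, and
`L` whose coefficients are the limits of the signed Riemann sums of the distribution `a ↦ εⁿ[a/pⁿ]⁺_f` (`hdist`,
`hlim`: THE Mazur–Tate–Teitelbaum function at `p ‖ N` with `ε = a_p`, MTT §I.10 `ε(p) = 0`), every `ϖ ∈ ℚ` and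
`B ≥ 0`: some coefficient of `ϖ·L` has norm `> B` iff some `‖ϖ‖·‖∑_η [η̄γˢ/p^{n+e₀}]⁺_f‖ > B` (the isometry
`…X2OrbitSupNorm.exists_lt_norm_lim_iff_exists_lt_norm_orbit` for `ϖ·εⁿ·[a/pⁿ]⁺_f`; NO bound on the symbols
enters). [cite: MazurTateTeitelbaum1986Invent, §I.10 and §I.12–I.13] -/
theorem exists_lt_norm_coeff_iff_exists_lt_norm_orbitSum [NeZero N] (hf : IsNewformOf W f) (ϖ : ℚ) {ε : ℚ_[p]}
    (hε : ‖ε‖ = 1)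
    (hdist : ∀ (n : ℕ) (a : ZMod (p ^ n)),
      ∑ b ∈ Finset.univ.filter (fun b : ZMod (p ^ (n + 1)) ↦
        ZMod.castHom (pow_dvd_pow p n.le_succ) (ZMod (p ^ n)) b = a),
          ε ^ (n + 1) * (ratPlusSymbol f ((b.val : ℚ) / (p : ℚ) ^ (n + 1)) : ℚ_[p]) =
        ε ^ n * (ratPlusSymbol f ((a.val : ℚ) / (p : ℚ) ^ n) : ℚ_[p]))
    {L : PowerSeries ℚ_[p]}
    (hlim : ∀ k : ℕ, Tendsto (fun n : ℕ ↦
        ∑ᶠ u : rootsOfUnity (torsionOrder p) ℤ_[p], ∑ s : ZMod (p ^ n),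
          (ε ^ (n + cyclotomicExponent p) *
            (ratPlusSymbol f
              (((PadicInt.toZModPow (n + cyclotomicExponent p) ((u : ℤ_[p]ˣ) : ℤ_[p]) *
                  (cyclotomicGenerator p : ZMod (p ^ (n + cyclotomicExponent p))) ^ s.val).val : ℚ) /
                (p : ℚ) ^ (n + cyclotomicExponent p)) : ℚ_[p])) *
            ((s.val.choose k : ℕ) : ℚ_[p]))
      atTop (𝓝 (PowerSeries.coeff k L)))
    {B : ℝ} (hB0 : 0 ≤ B) :
    (∃ k : ℕ, B < ‖PowerSeries.coeff k (PowerSeries.C ((ϖ : ℚ) : ℚ_[p]) * L)‖) ↔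
      ∃ (n : ℕ) (s : ZMod (p ^ n)), B < ‖((ϖ : ℚ) : ℚ_[p])‖ *
        ‖∑ᶠ ξ : rootsOfUnity (torsionOrder p) ℤ_[p],
          (ratPlusSymbol f ((((PadicInt.toZModPow (n + cyclotomicExponent p) ((ξ : ℤ_[p]ˣ) : ℤ_[p])) *
            (cyclotomicGenerator p : ZMod (p ^ (n + cyclotomicExponent p))) ^ s.val).val : ℚ) /
              (p : ℚ) ^ (n + cyclotomicExponent p)) : ℚ_[p])‖ := by
  classical
  haveI := neZero_torsionOrder p
  haveI := Fintype.ofFinite (rootsOfUnity (torsionOrder p) ℤ_[p])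
  -- the scaled signed distribution and its Riemann / orbit sums
  set μ : (n : ℕ) → ZMod (p ^ n) → ℚ_[p] := fun n a ↦
    ((ϖ : ℚ) : ℚ_[p]) * (ε ^ n * (ratPlusSymbol f ((a.val : ℚ) / (p : ℚ) ^ n) : ℚ_[p])) with hμ_def
  set RS : ℕ → ℕ → ℚ_[p] := fun k n ↦
    ∑ᶠ ξ : rootsOfUnity (torsionOrder p) ℤ_[p], ∑ s : ZMod (p ^ n),
      μ (n + cyclotomicExponent p)
          (PadicInt.toZModPow (n + cyclotomicExponent p) ((ξ : ℤ_[p]ˣ) : ℤ_[p]) *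
            (cyclotomicGenerator p : ZMod (p ^ (n + cyclotomicExponent p))) ^ s.val) *
        ((s.val.choose k : ℕ) : ℚ_[p]) with hRS_def
  set ν : (n : ℕ) → ZMod (p ^ n) → ℚ_[p] := fun n s ↦
    ∑ᶠ ξ : rootsOfUnity (torsionOrder p) ℤ_[p],
      μ (n + cyclotomicExponent p)
        (PadicInt.toZModPow (n + cyclotomicExponent p) ((ξ : ℤ_[p]ˣ) : ℤ_[p]) *
          (cyclotomicGenerator p : ZMod (p ^ (n + cyclotomicExponent p))) ^ s.val) with hν_def
  have hRS : ∀ k n : ℕ, RS k n =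
      ∑ᶠ ξ : rootsOfUnity (torsionOrder p) ℤ_[p], ∑ s : ZMod (p ^ n),
        μ (n + cyclotomicExponent p)
            (PadicInt.toZModPow (n + cyclotomicExponent p) ((ξ : ℤ_[p]ˣ) : ℤ_[p]) *
              (cyclotomicGenerator p : ZMod (p ^ (n + cyclotomicExponent p))) ^ s.val) *
          ((s.val.choose k : ℕ) : ℚ_[p]) := fun _ _ ↦ rfl
  have hν : ∀ (n : ℕ) (s : ZMod (p ^ n)), ν n s =
      ∑ᶠ ξ : rootsOfUnity (torsionOrder p) ℤ_[p],
        μ (n + cyclotomicExponent p)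
          (PadicInt.toZModPow (n + cyclotomicExponent p) ((ξ : ℤ_[p]ˣ) : ℤ_[p]) *
            (cyclotomicGenerator p : ZMod (p ^ (n + cyclotomicExponent p))) ^ s.val) := fun _ _ ↦ rfl
  -- distribution relation, boundedness of the orbit sums
  have hdist' : ∀ (n : ℕ) (a : ZMod (p ^ n)),
      ∑ b ∈ Finset.univ.filter (fun b : ZMod (p ^ (n + 1)) ↦
        ZMod.castHom (pow_dvd_pow p n.le_succ) (ZMod (p ^ n)) b = a), μ (n + 1) b = μ n a := by
    intro n a
    simp only [hμ_def]
    rw [← Finset.mul_sum, hdist n a]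
  obtain ⟨C, hC0⟩ := exists_norm_ratPlusSymbol_le (p := p) hf.1 hf.coeffField_eq_bot
  have hC : ∀ (n : ℕ) (a : ZMod (p ^ n)), ‖μ n a‖ ≤ ‖((ϖ : ℚ) : ℚ_[p])‖ * C := by
    intro n a
    simp only [hμ_def]
    rw [norm_mul, norm_mul, norm_pow, hε, one_pow, one_mul]
    exact mul_le_mul_of_nonneg_left (hC0 n a) (norm_nonneg _)
  have hV := norm_orbit_le_of_forall_norm_le hν hC
  -- the Riemann sums of `μ` converge to the coefficients of `ϖ·L`
  have hc : ∀ k : ℕ, Tendsto (fun m ↦ RS k m) atTop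
      (𝓝 (PowerSeries.coeff k (PowerSeries.C ((ϖ : ℚ) : ℚ_[p]) * L))) := by
    intro k
    have h := (hlim k).const_mul ((ϖ : ℚ) : ℚ_[p])
    rw [← PowerSeries.coeff_C_mul] at h
    refine h.congr fun m ↦ ?_
    simp only [hRS_def, hμ_def, finsum_eq_sum_of_fintype, Finset.mul_sum, mul_assoc]
  -- the isometry, and the orbit sums in symbol currency
  rw [exists_lt_norm_lim_iff_exists_lt_norm_orbit hRS hν hdist' hV hc hB0]
  refine exists_congr fun n ↦ exists_congr fun s ↦ ?_
  have hνns : ‖ν n s‖ = ‖((ϖ : ℚ) : ℚ_[p])‖ *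
      ‖∑ᶠ ξ : rootsOfUnity (torsionOrder p) ℤ_[p],
        (ratPlusSymbol f ((((PadicInt.toZModPow (n + cyclotomicExponent p) ((ξ : ℤ_[p]ˣ) : ℤ_[p])) *
          (cyclotomicGenerator p : ZMod (p ^ (n + cyclotomicExponent p))) ^ s.val).val : ℚ) /
            (p : ℚ) ^ (n + cyclotomicExponent p)) : ℚ_[p])‖ := by
    simp only [hν_def, hμ_def, finsum_eq_sum_of_fintype]
    rw [← Finset.mul_sum, ← Finset.mul_sum, norm_mul, norm_mul, norm_pow, hε, one_pow, one_mul]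
  rw [hνns]

/-- **Unit-coset repackaging** (`p` odd): a property of the orbit sums holds at some `(n, γˢ mod p^{n+1})` iff it
holds at some unit `u mod p^m`, `m ≥ 1` — every unit is `η̄γˢ` (`exists_coe_eq_toZModPow_mul_pow`) and the
orbit sum forgets `η̄` (`teichOrbitSum_toZModPow_mul`). [cite: Washington1997, §7.2 (ℤ_p^× = μ_{p−1} × (1 + pℤ_p))] -/
theorem exists_pow_iff_exists_unit (hp2 : p ≠ 2) (P : (m : ℕ) → ℚ → Prop) :
    (∃ (n : ℕ) (s : ZMod (p ^ n)),
        P (n + 1) (teichOrbitSum f p (n + 1) ((cyclotomicGenerator p : ZMod (p ^ (n + 1))) ^ s.val))) ↔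
      ∃ m : ℕ, 1 ≤ m ∧ ∃ u : (ZMod (p ^ m))ˣ, P m (teichOrbitSum f p m (u : ZMod (p ^ m))) := by
  refine ⟨fun ⟨n, s, h⟩ ↦ ?_, fun ⟨m, hm, u, h⟩ ↦ ?_⟩
  · obtain ⟨v, hv⟩ := isUnit_cyclotomicGenerator_cast p (n + 1)
    exact ⟨n + 1, Nat.succ_le_succ (Nat.zero_le n), v ^ s.val, by rwa [Units.val_pow_eq_pow_val, hv]⟩
  · obtain ⟨n, rfl⟩ : ∃ n, m = n + 1 := ⟨m - 1, by omega⟩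
    obtain ⟨ξ, s, hu⟩ := exists_coe_eq_toZModPow_mul_pow hp2 n u
    exact ⟨n, s, by rwa [hu, teichOrbitSum_toZModPow_mul f hp2 hm] at h⟩

end Datum

/-! ## §2. `X2.AnalyticMuLE` read in orbit-sum currency (odd multiplicative `p`, both signs) -/

section X2Reading

variable {W : WeierstrassCurve ℚ} [W.IsElliptic] [W.IsGloballyMinimal]

/-- **THE ORBIT-SUM READING OF THE TYPED ANALYTIC `μ` AT `p ‖ N`.** For `W/ℚ` multiplicative at an odd prime `p`
and every `m`: `X2.AnalyticMuLE W p m` holds IFF for every newform `f` of `W` and every `ϖ` with `ϖ·Ω_W = Ω⁺_f`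
there are `n ≥ 1` and a unit `u mod pⁿ` with `p^{-(m+1)} < ‖ϖ · ∑_{η^{p−1}=1} [ηu/pⁿ]⁺_f‖_p`
(`Rank1Residual.teichOrbitSum`). «⇒» by the existence of THE function (either sign), «⇐» by its Riemann sums,
both through §1. NO integrality, special-value or image hypothesis.
[cite: MazurTateTeitelbaum1986Invent, §I.10 (ε(p) = 0, α = a_p) and §I.12–I.13] [cite: GreenbergVatsal2000, p. 2–4, (2)–(3)] -/
theorem analyticMuLE_iff_forall_exists_teichOrbitSum (hp2 : p ≠ 2)
    (hmult : W.HasMultiplicativeReductionAtPrime p) (m : ℕ) :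
    X2.AnalyticMuLE W p m ↔
      ∀ {N : ℕ} [NeZero N] (f : CuspForm (Gamma0 N) 2), IsNewformOf W f →
        ∀ (ϖ : ℚ), (ϖ : ℝ) * W.realPeriodRat = plusPeriod f →
          ∃ n : ℕ, 1 ≤ n ∧ ∃ u : (ZMod (p ^ n))ˣ,
            (p : ℝ) ^ (-((m : ℤ) + 1)) < ‖((ϖ * teichOrbitSum f p n (u : ZMod (p ^ n)) : ℚ) : ℚ_[p])‖ := by
  have hB0 : (0 : ℝ) ≤ (p : ℝ) ^ (-((m : ℤ) + 1)) := by positivity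
  have he : cyclotomicExponent p = 1 := if_neg hp2
  -- §1 for the datum of either sign, in the `(n, γˢ)` form
  have key : ∀ {N : ℕ} [NeZero N] (f : CuspForm (Gamma0 N) 2), IsNewformOf W f → ∀ (ϖ : ℚ)
      (L : PowerSeries ℚ_[p]),
      (W.HasSplitMultiplicativeReductionAtPrime p → IsSplitMultPAdicLFunctionOf f p L) →
      (¬ W.HasSplitMultiplicativeReductionAtPrime p → IsMultPAdicLFunctionOf f p (-1) L) →
      ((∃ k : ℕ, (p : ℝ) ^ (-((m : ℤ) + 1)) <
          ‖PowerSeries.coeff k (PowerSeries.C ((ϖ : ℚ) : ℚ_[p]) * L)‖) ↔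
        ∃ (n : ℕ) (s : ZMod (p ^ n)), (p : ℝ) ^ (-((m : ℤ) + 1)) <
          ‖((ϖ * teichOrbitSum f p (n + 1) ((cyclotomicGenerator p : ZMod (p ^ (n + 1))) ^ s.val) : ℚ) :
            ℚ_[p])‖) := by
    intro N _ f hf ϖ L hLs hLn
    have hQ : coeffField f = ⊥ := hf.coeffField_eq_bot
    have hrat : ∀ r : ℚ, (ratPlusSymbol f r : ℝ) = normalizedPlusSymbol f r :=
      ratCast_ratPlusSymbol_holds hf.1 hQ
    -- the statement of §1 with `n + e₀` replaced by `n + 1`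
    suffices h : ∀ {ε : ℚ_[p]}, ‖ε‖ = 1 →
        (∀ (n : ℕ) (a : ZMod (p ^ n)),
          ∑ b ∈ Finset.univ.filter (fun b : ZMod (p ^ (n + 1)) ↦
            ZMod.castHom (pow_dvd_pow p n.le_succ) (ZMod (p ^ n)) b = a),
              ε ^ (n + 1) * (ratPlusSymbol f ((b.val : ℚ) / (p : ℚ) ^ (n + 1)) : ℚ_[p]) =
            ε ^ n * (ratPlusSymbol f ((a.val : ℚ) / (p : ℚ) ^ n) : ℚ_[p])) →
        (∀ k : ℕ, Tendsto (fun n : ℕ ↦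
          ∑ᶠ u : rootsOfUnity (torsionOrder p) ℤ_[p], ∑ s : ZMod (p ^ n),
            (ε ^ (n + cyclotomicExponent p) *
              (ratPlusSymbol f
                (((PadicInt.toZModPow (n + cyclotomicExponent p) ((u : ℤ_[p]ˣ) : ℤ_[p]) *
                    (cyclotomicGenerator p : ZMod (p ^ (n + cyclotomicExponent p))) ^ s.val).val : ℚ) /
                  (p : ℚ) ^ (n + cyclotomicExponent p)) : ℚ_[p])) *
              ((s.val.choose k : ℕ) : ℚ_[p])) atTop (𝓝 (PowerSeries.coeff k L))) →
        ((∃ k : ℕ, (p : ℝ) ^ (-((m : ℤ) + 1)) <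
            ‖PowerSeries.coeff k (PowerSeries.C ((ϖ : ℚ) : ℚ_[p]) * L)‖) ↔
          ∃ (n : ℕ) (s : ZMod (p ^ n)), (p : ℝ) ^ (-((m : ℤ) + 1)) <
            ‖((ϖ * teichOrbitSum f p (n + 1) ((cyclotomicGenerator p : ZMod (p ^ (n + 1))) ^ s.val) :
              ℚ) : ℚ_[p])‖) by
      by_cases hs : W.HasSplitMultiplicativeReductionAtPrime p
      · have hL := hLs hs
        have hap : cuspCoeff f p = 1 := (hf.cuspCoeff_eq_one_and_sq_of_split hs).1
        have hpN : p ∣ N := hf.dvd_level_of_split hs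
        have hfib := sum_fiber_ratPlusSymbol_eq hrat hf.1 hpN hap
        refine h (ε := 1) norm_one (fun n a ↦ ?_) fun k ↦ ?_
        · simp only [one_pow, one_mul]
          exact hfib n a
        · refine (hL.tendsto_riemannSum_coeff hs hf k).congr fun n ↦ ?_
          simp only [one_pow, one_mul]
      · have hL := hLn hs
        obtain ⟨hap, hpN⟩ := hf.cuspCoeff_eq_neg_one_and_dvd_of_nonsplit hmult hs
        have hfib := sum_fiber_ratPlusSymbol_eq_neg hrat hf.1 hpN hap
        refine h (ε := -1) (by rw [norm_neg, norm_one]) (fun n a ↦ ?_) fun k ↦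
          hL.tendsto_riemannSum_coeff_of_nonsplit hf hmult hs k
        rw [← Finset.mul_sum, hfib n a]
        ring
    intro ε hε hdist hlim
    rw [exists_lt_norm_coeff_iff_exists_lt_norm_orbitSum hf ϖ hε hdist hlim hB0, he]
    refine exists_congr fun n ↦ exists_congr fun s ↦ ?_
    rw [ratCast_mul_teichOrbitSum_eq f hp2 ϖ n s, norm_mul]
  constructor
  · intro h N _ f hf ϖ hϖ
    -- THE function exists (either sign); read `h` on it
    obtain ⟨L, hLs, hLn⟩ : ∃ L : PowerSeries ℚ_[p],
        (W.HasSplitMultiplicativeReductionAtPrime p → IsSplitMultPAdicLFunctionOf f p L) ∧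
        (¬ W.HasSplitMultiplicativeReductionAtPrime p → IsMultPAdicLFunctionOf f p (-1) L) := by
      by_cases hs : W.HasSplitMultiplicativeReductionAtPrime p
      · obtain ⟨L, hL⟩ := exists_isSplitMultPAdicLFunctionOf hs hf
        exact ⟨L, fun _ ↦ hL, fun hns ↦ absurd hs hns⟩
      · obtain ⟨L, hL⟩ := exists_isMultPAdicLFunctionOf_neg_one_of_nonsplit hf hmult hs
        exact ⟨L, fun hs' ↦ absurd hs' hs, fun _ ↦ hL⟩
    have h1 := (key f hf ϖ L hLs hLn).mp (h f hf ϖ hϖ L hLs hLn)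
    exact (exists_pow_iff_exists_unit (f := f) hp2 (fun _ q ↦ (p : ℝ) ^ (-((m : ℤ) + 1)) <
      ‖((ϖ * q : ℚ) : ℚ_[p])‖)).mp h1
  · intro h N _ f hf ϖ hϖ L hLs hLn
    exact (key f hf ϖ L hLs hLn).mpr ((exists_pow_iff_exists_unit (f := f) hp2
      (fun _ q ↦ (p : ℝ) ^ (-((m : ℤ) + 1)) < ‖((ϖ * q : ℚ) : ℚ_[p])‖)).mpr (h f hf ϖ hϖ))

/-- **`μ_an = 0` form**: `X2.AnalyticMuLE W p 0` ⟺ for every newform `f` of `W` and `ϖ` (`ϖ·Ω_W = Ω⁺_f`), SOME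
Néron-normalised Teichmüller-orbit sum `ϖ·∑_η [ηu/pⁿ]⁺_f`, `n ≥ 1`, has norm `> p⁻¹` (= is a `p`-adic UNIT
whenever the orbit sums are integral, e.g. under Wuthrich's Thm. 16). [cite: MazurTateTeitelbaum1986Invent, §I.10 and §I.12–I.13]
[cite: GreenbergVatsal2000, p. 2–4, (2)–(3)] -/
theorem analyticMuLE_zero_iff_forall_exists_teichOrbitSum_unit (hp2 : p ≠ 2)
    (hmult : W.HasMultiplicativeReductionAtPrime p) :
    X2.AnalyticMuLE W p 0 ↔
      ∀ {N : ℕ} [NeZero N] (f : CuspForm (Gamma0 N) 2), IsNewformOf W f →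
        ∀ (ϖ : ℚ), (ϖ : ℝ) * W.realPeriodRat = plusPeriod f →
          ∃ n : ℕ, 1 ≤ n ∧ ∃ u : (ZMod (p ^ n))ˣ,
            (p : ℝ)⁻¹ < ‖((ϖ * teichOrbitSum f p n (u : ZMod (p ^ n)) : ℚ) : ℚ_[p])‖ := by
  rw [analyticMuLE_iff_forall_exists_teichOrbitSum hp2 hmult 0]
  simp only [Nat.cast_zero, zero_add, zpow_neg, zpow_one]

end X2Reading

/-! ## §3. Doors for stub 3′ of line `mudescent` -/

section Doors

variable {W : WeierstrassCurve ℚ} [W.IsElliptic] [W.IsGloballyMinimal]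

/-- **PER-PAIR DOOR (stub 3′ at `(W, p)` from ONE unit orbit sum).** At an odd multiplicative prime: if for every
newform `f` of `W` and `ϖ` some Néron-normalised orbit sum `ϖ·∑_η [ηu/pⁿ]⁺_f`, `n ≥ 1`, has norm `> p⁻¹` (a
census row: `p − 1` exact plus symbols at one level), then the REGISTERED conclusion of `stub_muPart_offLocus`
holds at `(W, p)` (∘ `…MuPartTight.muPart_of_analyticMuLE_zero`, p611858). No `X2.CellB`, no off-locus
hypothesis, no named fact. [cite: MazurTateTeitelbaum1986Invent, §I.10 and §I.12–I.13] [cite: GreenbergVatsal2000, p. 2–4, (2)–(3)] -/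
theorem muPart_of_forall_exists_teichOrbitSum_unit (hp2 : p ≠ 2)
    (hmult : W.HasMultiplicativeReductionAtPrime p)
    (hcert : ∀ {N : ℕ} [NeZero N] (f : CuspForm (Gamma0 N) 2), IsNewformOf W f →
        ∀ (ϖ : ℚ), (ϖ : ℝ) * W.realPeriodRat = plusPeriod f →
          ∃ n : ℕ, 1 ≤ n ∧ ∃ u : (ZMod (p ^ n))ˣ,
            (p : ℝ)⁻¹ < ‖((ϖ * teichOrbitSum f p n (u : ZMod (p ^ n)) : ℚ) : ℚ_[p])‖) :
    ∀ (κ : ZpExtension ℚ p) (γ : Field.absoluteGaloisGroup ℚ),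
      κ.IsCyclotomic → κ.IsTopGenerator γ → IsCyclotomicVariable p γ →
      ∀ {N : ℕ} [NeZero N] (f : CuspForm (Gamma0 N) 2), IsNewformOf W f →
      ∀ (ϖ : ℚ), (ϖ : ℝ) * W.realPeriodRat = plusPeriod f →
      ∀ (L : PowerSeries ℚ_[p]),
        (W.HasSplitMultiplicativeReductionAtPrime p → IsSplitMultPAdicLFunctionOf f p L) →
        (¬ W.HasSplitMultiplicativeReductionAtPrime p → IsMultPAdicLFunctionOf f p (-1) L) →
      ∀ (D : W.SelmerDualData κ γ) (g G : IwasawaAlgebra p), D.charIdeal = Ideal.span {g} →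
        iwasawaToPowerSeries p G = PowerSeries.C ((ϖ : ℚ) : ℚ_[p]) * L → mu G ≤ mu g :=
  EisensteinPrimesMazurMCOnCellBMuPartTight.muPart_of_analyticMuLE_zero
    ((analyticMuLE_zero_iff_forall_exists_teichOrbitSum_unit hp2 hmult).mpr hcert)

/-- **THE LINE'S ANALYTIC μ-QUESTION AS A PLUS-SYMBOL STATEMENT (exact).** The v3 stub
`stub_analyticMuZero_offLocus` («`μ_an(W₀) = 0` at every X2b pair off the `μ`-barrier locus» = stub 3′ ∧
Greenberg's Conj. 1.11 on X2b, `…MuPartTight.analyticMuLE_zero_iff_muPart_and_forall_mu_eq_zero`) is EQUIVALENT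
to: at every such pair, for the newform `f` and the period ratio `ϖ`, SOME `ϖ·∑_{η^{p−1}=1}[ηu/pⁿ]⁺_f` (`n ≥ 1`,
`u` a unit) has norm `> p⁻¹`. Open class-wide on both sides (Stevens 1989 Conj. IV / Cor. 4.13, Greenberg–Vatsal
2000 §1 p. 15; no print on type A). [cite: Stevens1989, Conj. IV (4.5) and Cor. 4.13]
[cite: GreenbergVatsal2000, §1 p. 15 and (2)–(3)] [cite: MazurTateTeitelbaum1986Invent, §I.10 and §I.12–I.13] -/
theorem forall_offLocus_analyticMuLE_zero_iff_forall_offLocus_teichOrbitSum_unit :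
    (∀ (W₀ : WeierstrassCurve ℚ) [W₀.IsElliptic] [W₀.IsGloballyMinimal] (p : ℕ) [Fact p.Prime],
        X2.CellB W₀ p → ¬ HasRamifiedOddLineAt W₀ p → X2.AnalyticMuLE W₀ p 0) ↔
      ∀ (W₀ : WeierstrassCurve ℚ) [W₀.IsElliptic] [W₀.IsGloballyMinimal] (p : ℕ) [Fact p.Prime],
        X2.CellB W₀ p → ¬ HasRamifiedOddLineAt W₀ p →
          ∀ {N : ℕ} [NeZero N] (f : CuspForm (Gamma0 N) 2), IsNewformOf W₀ f →
            ∀ (ϖ : ℚ), (ϖ : ℝ) * W₀.realPeriodRat = plusPeriod f →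
              ∃ n : ℕ, 1 ≤ n ∧ ∃ u : (ZMod (p ^ n))ˣ,
                (p : ℝ)⁻¹ < ‖((ϖ * teichOrbitSum f p n (u : ZMod (p ^ n)) : ℚ) : ℚ_[p])‖ := by
  exact ⟨fun h W₀ _ _ p _ hc hoff ↦
      (analyticMuLE_zero_iff_forall_exists_teichOrbitSum_unit hc.2.1.1 hc.2.1.2.2).mp (h W₀ p hc hoff),
    fun h W₀ _ _ p _ hc hoff ↦
      (analyticMuLE_zero_iff_forall_exists_teichOrbitSum_unit hc.2.1.1 hc.2.1.2.2).mpr (h W₀ p hc hoff)⟩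

/-- **CLASS-WIDE DOOR (the REGISTERED v4 signature of `stub_muPart_offLocus`, verbatim, from the orbit
hypothesis).** If at every X2b pair off the locus some Néron-normalised Teichmüller-orbit sum, `n ≥ 1`, has norm
`> p⁻¹`, then stub 3′ holds (the hypothesis = the v3 stub by the previous theorem, STRONGER than stub 3′ by
Greenberg's Conj. 1.11 on X2b; the natural target of a modular-symbol / winding-span road at `p ‖ N`). The
hypothesis is OPEN class-wide; nothing is closed. [cite: Stevens1989, Conj. IV (4.5) and Cor. 4.13] [cite: MazurTateTeitelbaum1986Invent, §I.10 and §I.12–I.13] -/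
theorem stub_muPart_offLocus_of_forall_offLocus_teichOrbitSum_unit
    (h : ∀ (W₀ : WeierstrassCurve ℚ) [W₀.IsElliptic] [W₀.IsGloballyMinimal] (p : ℕ) [Fact p.Prime],
        X2.CellB W₀ p → ¬ HasRamifiedOddLineAt W₀ p →
          ∀ {N : ℕ} [NeZero N] (f : CuspForm (Gamma0 N) 2), IsNewformOf W₀ f →
            ∀ (ϖ : ℚ), (ϖ : ℝ) * W₀.realPeriodRat = plusPeriod f →
              ∃ n : ℕ, 1 ≤ n ∧ ∃ u : (ZMod (p ^ n))ˣ,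
                (p : ℝ)⁻¹ < ‖((ϖ * teichOrbitSum f p n (u : ZMod (p ^ n)) : ℚ) : ℚ_[p])‖) :
    ∀ (W₀ : WeierstrassCurve ℚ) [W₀.IsElliptic] [W₀.IsGloballyMinimal] (p : ℕ) [Fact p.Prime],
      X2.CellB W₀ p → ¬ HasRamifiedOddLineAt W₀ p →
      ∀ (κ : ZpExtension ℚ p) (γ : Field.absoluteGaloisGroup ℚ),
        κ.IsCyclotomic → κ.IsTopGenerator γ → IsCyclotomicVariable p γ →
        ∀ {N : ℕ} [NeZero N] (f : CuspForm (Gamma0 N) 2), IsNewformOf W₀ f →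
        ∀ (ϖ : ℚ), (ϖ : ℝ) * W₀.realPeriodRat = plusPeriod f →
        ∀ (L : PowerSeries ℚ_[p]),
          (W₀.HasSplitMultiplicativeReductionAtPrime p → IsSplitMultPAdicLFunctionOf f p L) →
          (¬ W₀.HasSplitMultiplicativeReductionAtPrime p → IsMultPAdicLFunctionOf f p (-1) L) →
        ∀ (D : W₀.SelmerDualData κ γ) (g G : IwasawaAlgebra p), D.charIdeal = Ideal.span {g} →
          iwasawaToPowerSeries p G = PowerSeries.C ((ϖ : ℚ) : ℚ_[p]) * L → mu G ≤ mu g := by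
  intro W₀ _ _ p _ hc hoff
  exact muPart_of_forall_exists_teichOrbitSum_unit hc.2.1.1 hc.2.1.2.2 (h W₀ p hc hoff)

end Doors

end Summit.BirchSwinnertonDyer.BirchSwinnertonDyer.Theorems.EisensteinPrimesX2AnalyticMuOrbitSum

end
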